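import Mathlib
import HarnessLib

/-!
# Zudilin 2014, first hypergeometric tale: the explicit linear forms `q(a,b) ζ(2) − p(a,b)` (Prop. 1)

Topic `Literature/NumberTheory/Irrationality/Zudilin2014`.  W. Zudilin, *Two hypergeometric tales and a new
irrationality measure of `ζ(2)`*, Ann. Math. Québec **38** (2014) 101–117 = arXiv:1310.1526 [Zudilin2014ZetaTwo],
Section 3.  For integer parameters `a = (a₁,a₂,a₃,a₄)`, `b = (b₁,b₂,b₃,b₄)` with (eq. (cond1))
`b₁,b₂,b₃ ≤ a₁,a₂,a₃,a₄ < b₄` and `d = Σ a − Σ b ≥ 0`, the rational function (eq. (gc))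
`R(t) = ∏_{j≤3} (t+b_j)⋯(t+a_j−1)/(a_j−b_j)! · (b₄−a₄−1)!/((t+a₄)⋯(t+b₄−1)) = Π(a,b)·∏_j Γ(t+a_j)/Γ(t+b_j)`
has the partial-fraction decomposition (eq. (P1)) `R(t) = Σ_{k=a₄*}^{b₄−1} C_k/(t+k) + P(t)`, `deg P = d`,
with (eq. (P2)) `C_k = (R(t)(t+k))|_{t=−k} ∈ ℤ`, and Proposition 1 writes the Barnes integral
`r(a,b) = (−1)^d (2πi)⁻¹ ∫ (π/sin πt)² R(t) dt` as `q(a,b) ζ(2) − p(a,b)` with (proof of Prop. 1, p. 6)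
`q = (−1)^d Σ_k C_k`, `p = (−1)^d Σ_k C_k Σ_{ℓ=1}^{k−a₂*} ℓ⁻² − Σ_{ℓ=0}^{d} (−1)^{d+ℓ} A_ℓ/(ℓ+1)` where
`P(t − a₂*) = Σ_ℓ A_ℓ P_ℓ(t)`, `P_ℓ(t) = (t−1)⋯(t−ℓ)/ℓ!` (Lemma 1), `a₂*` the second smallest of the `a_j`.

This file TYPES these objects for general integer parameters, with indices `a 0, a 1, a 2, a 3 = a₁, a₂, a₃, a₄`
and `b 0, b 1, b 2, b 3 = b₁, b₂, b₃, b₄` (numerator blocks `j = 0,1,2`, pole block `3`):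
* `block lo hi = ∏_{lo ≤ i < hi} (X + i) ∈ ℚ[X]`, `num`, `den`, `Pi` (`= Π(a,b)`), `R1 = num/∏(a_j−b_j)!`
  (Zudilin's `R₁`, p. 6), `eps k = (−1)^{k−a₄} C(b₄−a₄−1, k−a₄)` (the residues of `R₂ = (b₄−a₄−1)!/den`),
  `coefC k = eps k · R1(−k)` (`= C_k`, p. 6: "C_k = R₁(−k)·(−1)^{k−a₄} binom(b₄−a₄−1, k−a₄)"),
  `polyP = Σ_k eps k · (R1 − R1(−k))/(X + k)` (the polynomial part `P`), `coefA ℓ` (Newton coefficients of `P`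
  at the nodes `1 − a₂*, 2 − a₂*, …`), `amax = a₄*`, `a2star = a₂*`, `dExp = d`, and the forms `formQ = q(a,b)`,
  `formP = p(a,b)`;
* the PERMUTATION SYMMETRY behind Prop. 1's last sentence ("`r(a,b)/Π(a,b)` is invariant under any
  permutation of `a₁,…,a₄`"): `num (a ∘ σ) b * den a b = num a b * den (a ∘ σ) b` (`num_perm_mul_den`) — the
  Gamma-quotient `∏_j Γ(t+a_j)/Γ(t+b_j)` is symmetric in `a`.
The analytic identity `r = q ζ(2) − p` (Lemmas 1–2, Barnes integrals) is NOT formalised: `formQ`, `formP` are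
DEFINED by the printed closed formulas.  Companion files: `FirstTaleScaling` (the scaling law
`X(σa,b)·Π(a,b) = X(a,b)·Π(σa,b)` for `X = C_k, P, q, p`), `FirstTaleArithmetic` (integrality, Lemma 7).

Cell pub-zeta5 (HONEST FRAMING: systematic search; no irrationality claim unless certified): this is the
arithmetic skeleton of the two-tale `ζ(2)` programme (fam-measure point P15); no measure is claimed here.
-/

noncomputable section

open Polynomial Finset

namespace Literature.NumberTheory.Irrationality.Zudilin2014

/-! ### Parameters and admissibility (eq. (cond1)) -/

/-- **Admissible parameters** [cite: Zudilin2014ZetaTwo, Section 3, eq. (cond1)]: `b₁,b₂,b₃ ≤ a₁,a₂,a₃,a₄ < b₄`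
and `d = Σ a_j − Σ b_j ≥ 0` (indices shifted: `a 0..3 = a₁..a₄`, `b 0..3 = b₁..b₄`). -/
structure Admissible (a b : Fin 4 → ℤ) : Prop where
  /-- `b_j ≤ a_i` for `j ≤ 3` (here `j ≠ 3`) and all `i`. -/
  lower : ∀ j : Fin 4, j ≠ 3 → ∀ i : Fin 4, b j ≤ a i
  /-- `a_i < b₄`. -/
  upper : ∀ i : Fin 4, a i < b 3
  /-- `d ≥ 0`. -/
  balance : ∑ i, b i ≤ ∑ i, a i

/-- Admissibility is invariant under permutations of `a₁,…,a₄`. [cite: Zudilin2014ZetaTwo, Section 3, eq. (cond1)] -/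
theorem Admissible.perm {a b : Fin 4 → ℤ} (h : Admissible a b) (σ : Equiv.Perm (Fin 4)) :
    Admissible (a ∘ σ) b where
  lower j hj i := h.lower j hj (σ i)
  upper i := h.upper (σ i)
  balance := by
    have : ∑ i, (a ∘ σ) i = ∑ i, a i := Fintype.sum_equiv σ _ _ fun _ => rfl
    rw [this]; exact h.balance

/-! ### The rational function `R(a,b;t)` (eq. (gc)) -/

/-- The linear block `∏_{lo ≤ i < hi} (X + i)` (`= (t+lo)(t+lo+1)⋯(t+hi−1)`, empty product `1` if `hi ≤ lo`). [cite: Zudilin2014ZetaTwo, Section 3, eq. (gc)] -/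
def block (lo hi : ℤ) : ℚ[X] := ∏ i ∈ Ico lo hi, (X + C (i : ℚ))

/-- The numerator `∏_{j=1}^{3} (t+b_j)⋯(t+a_j−1)` of `R` (without the factorials). [cite: Zudilin2014ZetaTwo, Section 3, eq. (gc)] -/
def num (a b : Fin 4 → ℤ) : ℚ[X] := block (b 0) (a 0) * block (b 1) (a 1) * block (b 2) (a 2)

/-- The denominator `(t+a₄)⋯(t+b₄−1)` of `R`. [cite: Zudilin2014ZetaTwo, Section 3, eq. (gc)] -/
def den (a b : Fin 4 → ℤ) : ℚ[X] := block (a 3) (b 3)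

/-- `m! ` for an integer `m` (via `toNat`; used only for `m ≥ 0`). [cite: Zudilin2014ZetaTwo, Section 3, eq. (gc) (factorial normalisations)] -/
def facZ (m : ℤ) : ℚ := (m.toNat.factorial : ℚ)

/-- The factorial normalisation `∏_{j=1}^{3} (a_j − b_j)!` of the numerator. [cite: Zudilin2014ZetaTwo, Section 3, eq. (gc)] -/
def numFac (a b : Fin 4 → ℤ) : ℚ := facZ (a 0 - b 0) * facZ (a 1 - b 1) * facZ (a 2 - b 2)

/-- **`Π(a,b) = (b₄−a₄−1)!/((a₁−b₁)!(a₂−b₂)!(a₃−b₃)!)`** [cite: Zudilin2014ZetaTwo, Section 3, after eq. (gc)]. -/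
def Pi (a b : Fin 4 → ℤ) : ℚ := facZ (b 3 - a 3 - 1) / numFac a b

/-- Zudilin's `R₁(t) = ∏_{j=1}^{3} (t+b_j)⋯(t+a_j−1)/(a_j−b_j)!` (proof of Lemma 5), a polynomial. [cite: Zudilin2014ZetaTwo, proof of Lemma 5] -/
def R1 (a b : Fin 4 → ℤ) : ℚ[X] := C (numFac a b)⁻¹ * num a b

/-- **`R(a,b;t) = Π(a,b) · num(t)/den(t)`** [cite: Zudilin2014ZetaTwo, Section 3, eq. (gc)], as a function on `ℚ`
(meaningful off the zeros of `den`). -/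
def R (a b : Fin 4 → ℤ) (t : ℚ) : ℚ := Pi a b * (num a b).eval t / (den a b).eval t

/-! ### Partial fractions (eq. (P1), (P2)) and the forms `q`, `p` (Proposition 1) -/

/-- `ε_k = (−1)^{k−a₄} binom(b₄−a₄−1, k−a₄)`: the residue at `t = −k` of
`R₂(t) = (b₄−a₄−1)!/((t+a₄)⋯(t+b₄−1))` (proof of Lemma 5), for `a₄ ≤ k < b₄`. [cite: Zudilin2014ZetaTwo, proof of Lemma 5] -/
def eps (a b : Fin 4 → ℤ) (k : ℤ) : ℚ :=
  (-1) ^ (k - a 3).toNat * (Nat.choose (b 3 - a 3 - 1).toNat (k - a 3).toNat : ℚ)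

/-- **`C_k = R₁(−k) · (−1)^{k−a₄} binom(b₄−a₄−1, k−a₄)`** [cite: Zudilin2014ZetaTwo, Section 3, eq. (P2) and
proof of Lemma 5]. -/
def coefC (a b : Fin 4 → ℤ) (k : ℤ) : ℚ := eps a b k * (R1 a b).eval (-(k : ℚ))

/-- The exact quotient `(F − F(−k))/(X + k)` (a polynomial). [cite: Zudilin2014ZetaTwo, Section 3, eq. (P1) (exact division by a linear factor)] -/
def dq (F : ℚ[X]) (k : ℤ) : ℚ[X] := (F - C (F.eval (-(k : ℚ)))) /ₘ (X + C (k : ℚ))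

/-- **The polynomial part `P(t)` of `R(t)`** (eq. (P1)): `P = Σ_{k=a₄}^{b₄−1} ε_k · (R₁(t) − R₁(−k))/(t + k)`
(from `R = R₁ R₂`, `R₂ = Σ_k ε_k/(t+k)`; see `FirstTaleScaling.R_eq_polyP_add_polar`). [cite: Zudilin2014ZetaTwo, Section 3, eq. (P1)] -/
def polyP (a b : Fin 4 → ℤ) : ℚ[X] := ∑ k ∈ Ico (a 3) (b 3), C (eps a b k) * dq (R1 a b) k

/-- `a₄* = max_j a_j` (the poles of `R` are `t = −k`, `a₄* ≤ k < b₄`). [cite: Zudilin2014ZetaTwo, Section 3 (ordered parameters)] -/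
def amax (a : Fin 4 → ℤ) : ℤ := max (max (a 0) (a 1)) (max (a 2) (a 3))

/-- `min_{j ≠ i} a_j`. [cite: Zudilin2014ZetaTwo, Section 3 (ordered parameters a₁* ≤ a₂* ≤ a₃* ≤ a₄*)] -/
def minOthers (a : Fin 4 → ℤ) (i : Fin 4) : ℤ := (univ.erase i).inf' ⟨i + 1, by simp⟩ a

/-- **`a₂*`, the second smallest of `a₁,…,a₄`** (`= max_i min_{j≠i} a_j`). [cite: Zudilin2014ZetaTwo, Section 3 (ordered parameters)] -/
def a2star (a : Fin 4 → ℤ) : ℤ := univ.sup' univ_nonempty (minOthers a)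

/-- `d = Σ a_j − Σ b_j` as a natural number (admissibility gives `d ≥ 0`). [cite: Zudilin2014ZetaTwo, Section 3, eq. (cond1)] -/
def dExp (a b : Fin 4 → ℤ) : ℕ := (∑ i, a i - ∑ i, b i).toNat

/-- **The Newton coefficients `A_ℓ`** of `P(t − a₂*) = Σ_ℓ A_ℓ P_ℓ(t)`, `P_ℓ(t) = (t−1)⋯(t−ℓ)/ℓ!`
(proof of Prop. 1): `A_ℓ = Δ^ℓ[P](1 − a₂*) = Σ_{i ≤ ℓ} (−1)^{ℓ−i} binom(ℓ,i) P(1 + i − a₂*)`. [cite: Zudilin2014ZetaTwo, proof of Proposition 1] -/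
def coefA (a b : Fin 4 → ℤ) (ℓ : ℕ) : ℚ :=
  ∑ i ∈ range (ℓ + 1), (-1) ^ (ℓ - i) * (Nat.choose ℓ i : ℚ) * (polyP a b).eval ((1 : ℚ) + i - a2star a)

/-- `H₂(m) = Σ_{ℓ=1}^{m} ℓ⁻²`. [cite: Zudilin2014ZetaTwo, Lemma 2 (the finite sums Σ ℓ⁻²)] -/
def harmTwo (m : ℕ) : ℚ := ∑ l ∈ range m, 1 / ((l + 1 : ℚ) ^ 2)

/-- **`q(a,b) = (−1)^d Σ_{k=a₄*}^{b₄−1} C_k`** [cite: Zudilin2014ZetaTwo, proof of Proposition 1 and Remark 5]. -/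
def formQ (a b : Fin 4 → ℤ) : ℚ := (-1) ^ dExp a b * ∑ k ∈ Ico (amax a) (b 3), coefC a b k

/-- **`p(a,b) = (−1)^d [ Σ_k C_k Σ_{ℓ=1}^{k−a₂*} ℓ⁻² − Σ_{ℓ=0}^{d} (−1)^ℓ A_ℓ/(ℓ+1) ]`**
[cite: Zudilin2014ZetaTwo, proof of Proposition 1]. -/
def formP (a b : Fin 4 → ℤ) : ℚ :=
  (-1) ^ dExp a b * (∑ k ∈ Ico (amax a) (b 3), coefC a b k * harmTwo (k - a2star a).toNat
    - ∑ l ∈ range (dExp a b + 1), (-1) ^ l * coefA a b l / (l + 1))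

/-! ### Basic facts about the blocks -/

/-- `block lo hi` is monic. [cite: Zudilin2014ZetaTwo, Section 3, eq. (gc)] -/
theorem monic_block (lo hi : ℤ) : (block lo hi).Monic :=
  monic_prod_of_monic _ _ fun _ _ => monic_X_add_C _

/-- `block lo hi ≠ 0`. [cite: Zudilin2014ZetaTwo, Section 3, eq. (gc)] -/
theorem block_ne_zero (lo hi : ℤ) : block lo hi ≠ 0 := (monic_block lo hi).ne_zero

/-- Evaluation: `block lo hi (t) = ∏_{lo ≤ i < hi} (t + i)`. [cite: Zudilin2014ZetaTwo, Section 3, eq. (gc)] -/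
theorem eval_block (lo hi : ℤ) (t : ℚ) : (block lo hi).eval t = ∏ i ∈ Ico lo hi, (t + i) := by
  unfold block; rw [eval_prod]; simp

/-- Splitting a block: `block lo hi = block lo mi * block mi hi` for `lo ≤ mi ≤ hi`. [cite: Zudilin2014ZetaTwo, Section 3, eq. (gc)] -/
theorem block_mul_block {lo mi hi : ℤ} (h₁ : lo ≤ mi) (h₂ : mi ≤ hi) :
    block lo mi * block mi hi = block lo hi := by
  unfold block
  rw [← prod_union (Ico_disjoint_Ico_consecutive lo mi hi), Ico_union_Ico_eq_Ico h₁ h₂]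

/-- `deg block lo hi = hi − lo` (as `toNat`). [cite: Zudilin2014ZetaTwo, Section 3, eq. (gc)] -/
theorem natDegree_block (lo hi : ℤ) : (block lo hi).natDegree = (hi - lo).toNat := by
  unfold block
  rw [natDegree_prod_of_monic _ _ fun _ _ => monic_X_add_C _]
  simp_rw [natDegree_X_add_C]
  rw [sum_const, Int.card_Ico, smul_eq_mul, mul_one]

/-- The roots of a block: `block lo hi (t) = 0 ↔ t = −i` for some `lo ≤ i < hi`. [cite: Zudilin2014ZetaTwo, Section 3 (poles and zeroes of R)] -/
theorem eval_block_eq_zero_iff (lo hi : ℤ) (t : ℚ) :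
    (block lo hi).eval t = 0 ↔ ∃ i ∈ Ico lo hi, t = -(i : ℚ) := by
  rw [eval_block, prod_eq_zero_iff]
  simp only [add_eq_zero_iff_eq_neg]

/-- Off the integers `−i`, `lo ≤ i < hi`, the block does not vanish. [cite: Zudilin2014ZetaTwo, Section 3 (poles and zeroes of R)] -/
theorem eval_block_ne_zero {lo hi : ℤ} {t : ℚ} (h : ∀ i ∈ Ico lo hi, t ≠ -(i : ℚ)) :
    (block lo hi).eval t ≠ 0 := fun h0 => by
  obtain ⟨i, hi, rfl⟩ := (eval_block_eq_zero_iff lo hi t).1 h0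
  exact h i hi rfl

/-- `num`, `den` are monic. [cite: Zudilin2014ZetaTwo, Section 3, eq. (gc)] -/
theorem monic_num (a b : Fin 4 → ℤ) : (num a b).Monic :=
  ((monic_block _ _).mul (monic_block _ _)).mul (monic_block _ _)

/-- `den` is monic. [cite: Zudilin2014ZetaTwo, Section 3, eq. (gc)] -/
theorem monic_den (a b : Fin 4 → ℤ) : (den a b).Monic := monic_block _ _

/-- `numFac ≠ 0`. [cite: Zudilin2014ZetaTwo, Section 3, eq. (gc)] -/
theorem numFac_ne_zero (a b : Fin 4 → ℤ) : numFac a b ≠ 0 := by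
  unfold numFac facZ; positivity

/-- `Π(a,b) ≠ 0`. [cite: Zudilin2014ZetaTwo, Section 3, eq. (gc)] -/
theorem Pi_ne_zero (a b : Fin 4 → ℤ) : Pi a b ≠ 0 := by
  unfold Pi facZ; exact div_ne_zero (by positivity) (numFac_ne_zero a b)

/-! ### The permutation symmetry of `num/den` -/

/-- The telescoping base: `block L lo * block lo hi = block L hi`. [cite: Zudilin2014ZetaTwo, Section 3, eq. (gc)] -/
private theorem base_mul {L lo hi : ℤ} (h₁ : L ≤ lo) (h₂ : lo ≤ hi) :
    block L lo * block lo hi = block L hi := block_mul_block h₁ h₂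

/-- **Permutation symmetry of the Gamma quotient** [cite: Zudilin2014ZetaTwo, Proposition 1, last claim]: for
admissible `(a,b)` and any permutation `σ` of the indices of `a`,
`num(σa,b) · den(a,b) = num(a,b) · den(σa,b)` in `ℚ[X]` — both sides equal
`∏_{i} Γ(t+a_i)·Γ-free normalisation`; formally: after multiplying by the common nonzero factor
`∏_{j<3} block L b_j · block L a₄ · block L a_{σ4}` both become `∏_{i<4} block L a_i · block L b₄`. -/
theorem num_perm_mul_den {a b : Fin 4 → ℤ} (h : Admissible a b) (σ : Equiv.Perm (Fin 4)) :
    num (a ∘ σ) b * den a b = num a b * den (a ∘ σ) b := by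
  -- common lower bound
  set L : ℤ := min (b 0) (min (b 1) (b 2)) with hL
  have hLb0 : L ≤ b 0 := min_le_left _ _
  have hLb1 : L ≤ b 1 := (min_le_right _ _).trans (min_le_left _ _)
  have hLb2 : L ≤ b 2 := (min_le_right _ _).trans (min_le_right _ _)
  have hba : ∀ i, b 0 ≤ a i := h.lower 0 (by decide)
  have hb1a : ∀ i, b 1 ≤ a i := h.lower 1 (by decide)
  have hb2a : ∀ i, b 2 ≤ a i := h.lower 2 (by decide)
  have hLa : ∀ i, L ≤ a i := fun i => hLb0.trans (hba i)
  have hab : ∀ i, a i ≤ b 3 := fun i => (h.upper i).le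
  -- F(m) := block L m
  set F : ℤ → ℚ[X] := fun m => block L m with hF
  have hnum : ∀ τ : Equiv.Perm (Fin 4),
      num (a ∘ τ) b * (F (b 0) * F (b 1) * F (b 2)) = F (a (τ 0)) * F (a (τ 1)) * F (a (τ 2)) := by
    intro τ
    have e0 : F (b 0) * block (b 0) (a (τ 0)) = F (a (τ 0)) := base_mul hLb0 (hba _)
    have e1 : F (b 1) * block (b 1) (a (τ 1)) = F (a (τ 1)) := base_mul hLb1 (hb1a _)
    have e2 : F (b 2) * block (b 2) (a (τ 2)) = F (a (τ 2)) := base_mul hLb2 (hb2a _)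
    simp only [num, Function.comp_apply]
    rw [← e0, ← e1, ← e2]; ring
  have hden : ∀ τ : Equiv.Perm (Fin 4), den (a ∘ τ) b * F (a (τ 3)) = F (b 3) := by
    intro τ
    simp only [den, Function.comp_apply]
    rw [mul_comm]; exact base_mul (hLa _) (hab _)
  -- the symmetric total product
  have hsym : F (a (σ 0)) * F (a (σ 1)) * F (a (σ 2)) * F (a (σ 3)) = F (a 0) * F (a 1) * F (a 2) * F (a 3) := by
    have e : ∏ i, F (a (σ i)) = ∏ i, F (a i) := Fintype.prod_equiv σ _ _ fun _ => rfl
    simpa [Fin.prod_univ_four] using e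
  -- cancel the common factor Z
  have hZ : F (b 0) * F (b 1) * F (b 2) * F (a 3) * F (a (σ 3)) ≠ 0 := by
    simp only [hF]; exact mul_ne_zero (mul_ne_zero (mul_ne_zero (mul_ne_zero (block_ne_zero _ _)
      (block_ne_zero _ _)) (block_ne_zero _ _)) (block_ne_zero _ _)) (block_ne_zero _ _)
  apply mul_right_cancel₀ hZ
  have h1 := hnum σ
  have h2 := hnum 1
  have h3 := hden σ
  have h4 := hden 1
  simp only [Equiv.Perm.coe_one, Function.comp_id, id] at h2 h4
  calc num (a ∘ σ) b * den a b * (F (b 0) * F (b 1) * F (b 2) * F (a 3) * F (a (σ 3)))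
      = (num (a ∘ σ) b * (F (b 0) * F (b 1) * F (b 2))) * (den a b * F (a 3)) * F (a (σ 3)) := by ring
    _ = F (a (σ 0)) * F (a (σ 1)) * F (a (σ 2)) * F (a (σ 3)) * F (b 3) := by rw [h1, h4]; ring
    _ = F (a 0) * F (a 1) * F (a 2) * F (a 3) * F (b 3) := by rw [hsym]
    _ = (num a b * (F (b 0) * F (b 1) * F (b 2))) * (den (a ∘ σ) b * F (a (σ 3))) * F (a 3) := by
          rw [h2, h3]; ring
    _ = num a b * den (a ∘ σ) b * (F (b 0) * F (b 1) * F (b 2) * F (a 3) * F (a (σ 3))) := by ring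

/-- `numFac`, `Pi`, `den` only see `b` and the multiset of `a`: under `σ` the normalisations change but the
quotient `num/den` does not; the induced **scaling law for `R`**: off the poles,
`R(σa,b;t) · Π(a,b) = R(a,b;t) · Π(σa,b)`. [cite: Zudilin2014ZetaTwo, Proposition 1] -/
theorem R_perm_mul_Pi {a b : Fin 4 → ℤ} (h : Admissible a b) (σ : Equiv.Perm (Fin 4)) {t : ℚ}
    (ht : (den a b).eval t ≠ 0) (ht' : (den (a ∘ σ) b).eval t ≠ 0) :
    R (a ∘ σ) b t * Pi a b = R a b t * Pi (a ∘ σ) b := by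
  have e := congrArg (fun F : ℚ[X] => F.eval t) (num_perm_mul_den h σ)
  simp only [eval_mul] at e
  unfold R
  field_simp
  linear_combination Pi a b * Pi (a ∘ σ) b * e

/-! ### Invariance of `amax`, `a2star`, `dExp` under permutations -/

/-- `amax = univ.sup' a`. [cite: Zudilin2014ZetaTwo, Section 3 (ordered parameters)] -/
theorem amax_eq_sup' (a : Fin 4 → ℤ) : amax a = univ.sup' univ_nonempty a := by
  unfold amax
  apply le_antisymm
  · refine max_le (max_le ?_ ?_) (max_le ?_ ?_) <;> exact le_sup' a (mem_univ _)
  · refine sup'_le _ _ fun i _ => ?_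
    fin_cases i <;> simp

/-- `a_i ≤ amax a`. [cite: Zudilin2014ZetaTwo, Section 3 (ordered parameters)] -/
theorem le_amax (a : Fin 4 → ℤ) (i : Fin 4) : a i ≤ amax a := by
  rw [amax_eq_sup']; exact le_sup' a (mem_univ i)

/-- `amax (a ∘ σ) = amax a`. [cite: Zudilin2014ZetaTwo, Section 3 (ordered parameters) and Proposition 1] -/
theorem amax_perm (a : Fin 4 → ℤ) (σ : Equiv.Perm (Fin 4)) : amax (a ∘ σ) = amax a := by
  rw [amax_eq_sup', amax_eq_sup']
  apply le_antisymm
  · exact sup'_le _ _ fun i _ => le_sup' a (mem_univ (σ i))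
  · refine sup'_le _ _ fun i _ => ?_
    have : a i = (a ∘ σ) (σ.symm i) := by simp
    rw [this]; exact le_sup' (a ∘ σ) (mem_univ _)

/-- `minOthers (a ∘ σ) i = minOthers a (σ i)`. [cite: Zudilin2014ZetaTwo, Section 3 (ordered parameters) and Proposition 1] -/
theorem minOthers_perm (a : Fin 4 → ℤ) (σ : Equiv.Perm (Fin 4)) (i : Fin 4) :
    minOthers (a ∘ σ) i = minOthers a (σ i) := by
  unfold minOthers
  apply le_antisymm
  · refine le_inf' _ _ fun j hj => ?_
    have hj' : σ.symm j ∈ univ.erase i := by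
      rw [mem_erase] at hj ⊢; exact ⟨fun h => hj.1 (by rw [← h]; simp), mem_univ _⟩
    have := inf'_le (a ∘ σ) hj'
    simpa using this
  · refine le_inf' _ _ fun j hj => ?_
    have hj' : σ j ∈ univ.erase (σ i) := by
      rw [mem_erase] at hj ⊢; exact ⟨fun h => hj.1 (σ.injective h), mem_univ _⟩
    exact inf'_le a hj'

/-- **`a₂*` is permutation invariant.** [cite: Zudilin2014ZetaTwo, Section 3 (ordered parameters) and Proposition 1] -/
theorem a2star_perm (a : Fin 4 → ℤ) (σ : Equiv.Perm (Fin 4)) : a2star (a ∘ σ) = a2star a := by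
  unfold a2star
  apply le_antisymm
  · refine sup'_le _ _ fun i _ => ?_
    rw [minOthers_perm]; exact le_sup' (minOthers a) (mem_univ _)
  · refine sup'_le _ _ fun i _ => ?_
    have : minOthers a i = minOthers (a ∘ σ) (σ.symm i) := by rw [minOthers_perm]; simp
    rw [this]; exact le_sup' (minOthers (a ∘ σ)) (mem_univ _)

/-- `minOthers a i ≤ a j` for `j ≠ i`. [cite: Zudilin2014ZetaTwo, Section 3 (ordered parameters)] -/
theorem minOthers_le (a : Fin 4 → ℤ) {i j : Fin 4} (hij : j ≠ i) : minOthers a i ≤ a j :=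
  inf'_le a (mem_erase.2 ⟨hij, mem_univ j⟩)

/-- `a₂* ≤ a₄* ` (`a2star ≤ amax`). [cite: Zudilin2014ZetaTwo, Section 3 (ordered parameters)] -/
theorem a2star_le_amax (a : Fin 4 → ℤ) : a2star a ≤ amax a := by
  unfold a2star
  refine sup'_le _ _ fun i _ => ?_
  obtain ⟨j, hj⟩ : ∃ j : Fin 4, j ≠ i := ⟨i + 1, by simp⟩
  exact (minOthers_le a hj).trans (le_amax a j)

/-- **Second-smallest property**: if `a i₀ < a₂*` then every other `a j` is `≥ a₂*`. [cite: Zudilin2014ZetaTwo, Section 3 (ordered parameters)] -/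
theorem a2star_le_of_lt {a : Fin 4 → ℤ} {i₀ : Fin 4} (h : a i₀ < a2star a) {j : Fin 4} (hj : j ≠ i₀) :
    a2star a ≤ a j := by
  obtain ⟨i', _, hi'⟩ := exists_mem_eq_sup' (univ_nonempty (α := Fin 4)) (minOthers a)
  have e : a2star a = minOthers a i' := hi'
  by_cases h0 : i' = i₀
  · rw [e, h0]; exact minOthers_le a hj
  · have : a2star a ≤ a i₀ := by rw [e]; exact minOthers_le a (fun hh => h0 hh.symm)
    exact absurd this (not_le.2 h)

/-- `dExp (a ∘ σ) b = dExp a b`. [cite: Zudilin2014ZetaTwo, Section 3, eq. (cond1) and Proposition 1] -/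
theorem dExp_perm (a b : Fin 4 → ℤ) (σ : Equiv.Perm (Fin 4)) : dExp (a ∘ σ) b = dExp a b := by
  unfold dExp
  have : ∑ i, (a ∘ σ) i = ∑ i, a i := Fintype.sum_equiv σ _ _ fun _ => rfl
  rw [this]

end Literature.NumberTheory.Irrationality.Zudilin2014

end
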